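import Summits.CriticalPhenomena.PercolationContinuityZ3.Theorems.PercNearOneGluingNoHeavyConstsClusterSquareW4Minor
import Summits.CriticalPhenomena.PercolationContinuityZ3.Theorems.PercNearOneGluingNoHeavyConstsClusterSquareApicesQuadLinked
import Summits.CriticalPhenomena.PercolationContinuityZ3.Theorems.PercNearOneGluingNoHeavyConstsClusterSquareQuadClash
import HarnessLib

/-!
# CSQ, DUU and TS on every series-parallel graph — and on every graph without a `W₄` minor

builds on p205010 (kernel theorem, internal audit signed; external expert review pending)

PAPER-2 track "percolation constants", part (ii), seat `prim-consts-1`, gen 23 (lane index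
`run/shared/lean/prim/consts/CONSTANTS.md`, row A19; memo `FROM-prim-consts-1-g23-SERIES-PARALLEL.md`).
Support file for the crux `NoHeavyLowerTail` (stmt-CriticalPhenomena-4575; `--supports`).  Theorems only; no definitions, no sorries.

Notation (`μ = prodBernoulli w` on `Fin n`, terminals `a, b, c`): CSQ `clusterSquare w a b c ≤ μ(b↮c)²` (`Consts.ClusterSquareSplit`,
gen 15), DUU `μ(a↮b, a↮c, b↮c)² ≤ μ(a↮b, a↮c)·μ(b↮c)²` (`Consts.RootedSplit`), TS `μ(a↮b, a↮c, b↮c)² ≤ μ(a↮b)·μ(a↮c)·μ(b↮c)`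
(`Consts.TripleSplit`) — all three OPEN for general finite weighted graphs.

THE RESULT.  Let `H` be a graph on `Fin n` carrying every positive pair of `w`.
* **`Consts.tripleSplit_of_noW4Minor`** (with `clusterSquare_le_sq_of_noW4Minor`, `sq_real_split_le_of_noW4Minor`): if `H` has NO
  `W₄` MINOR (no hub set and four rim sets, pairwise disjoint, each inducing a connected subgraph, hub joined to every rim set, rim
  sets joined cyclically) then CSQ and DUU hold at EVERY root `a` and TS for EVERY triple `a, b, c`.
* **`Consts.tripleSplit_of_noK4Minor`** (with `clusterSquare_le_sq_of_noK4Minor`, `sq_real_split_le_of_noK4Minor`): the same for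
  graphs with NO `K₄` MINOR — the SERIES-PARALLEL graphs (treewidth `≤ 2`; Duffin 1965: no subdivision of `K₄`); concrete form on
  the positive-pair graph: **`Consts.tripleSplit_seriesParallel`**.
The class of `W₄`-minor-free graphs consists of the `≤ 2`-sums of series-parallel graphs and copies of `K₄`; it contains every
outerplanar graph (gen 19), every `K_{2,m}` (gen 18), every theta graph and cactus (gens 8, 12), `K₄` (gen 13) and all graphs
whose non-terminals have degree `≤ 2` (gen 17), so this file subsumes `tripleSplit_of_nonCrossing`, `…_wheel` for `N ≤ 3`,
`…K2m`, `…_of_degree_le_two`, `tripleSplit_K4` as far as the graph class goes, and it answers question (γ) of the lane memo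
`FROM-prim-consts-1-g13-SKELETON.md` §3 ("TS on all `K₄`-minor-free graphs needs a composition theorem") WITHOUT a composition
theorem: the two-copy criterion applies at every root.
MECHANISM (`…ConstsClusterSquareW4Minor.lean`): a quadruple clash at `(a; b, c)` is a cross-linkage of four clash vertices at the
cluster `C_a(ω)` (gen 22, `Consts.not_quadClash_of_unlinked₄`), and a cross-linkage at a connected set is a `W₄` minor with the set
inside the hub (`Consts.noCrossLinkage_of_noW4Minor`); conversely a `W₄` model is a cross-linkage at its hub, so `W₄`-minor-free is
the EXACT graph class on which the two-copy method works at every root irrespective of the terminals (the lane census of gen 18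
found quadruple clashes at `W₄` rooted at the hub, `K₅`, the octahedron, the cube).
Census (lane g23, exact enumeration, all 12 113 connected graphs on `≤ 8` vertices up to isomorphism,
`prim-consts-1/g23/eng/{k4,w4}_census*.py`): cross-linkage at some connected set ⟺ `W₄` minor on every graph; the 1 566
`K₄`-minor-free graphs among them carry none.  TS itself: 0 violations in the lane censuses (CONSTANTS.md A19).
References: N. Gladkov, arXiv:2408.08457v2 (2024), Def. 4.2, Thm. 4.3, Lemma 3.1, Ex. 2.5, Thm. 5.2, Cor. 5.3; J. van den Berg,
O. Häggström, J. Kahn, Random Structures Algorithms 29 (2006), §1; R. J. Duffin, J. Math. Anal. Appl. 10 (1965) 303–318;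
R. Diestel, Graph Theory (5th ed.), §1.7, §7.3.
-/

noncomputable section

namespace Summit.CriticalPhenomena.PercolationContinuityZ3.Theorems

open MeasureTheory Literature.Probability.LatticeModels Literature.Probability.Percolation

namespace Consts

/-! ### `W₄`-minor-free graphs: CSQ and DUU at every root, TS for every triple -/

section Fin

variable {n : ℕ} (w : Sym2 (Fin n) → unitInterval) (a b c : Fin n) (H : SimpleGraph (Fin n))

/-- **CSQ at EVERY root of a `W₄`-minor-free graph** (`H ⊇` positive pairs of `w`; no hub-and-four-rim-sets model of the 4-wheel in
`H`): `clusterSquare w a b c ≤ μ(b ↮ c)²` for all `a, b, c`, via "no quadruple clash" — a quadruple clash is a cross-linkage at the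
cluster of `a`, i.e. a `W₄` minor. [cite: Gladkov2024, Thm. 4.3, Def. 4.2, Lemma 3.1, Ex. 2.5] -/
theorem clusterSquare_le_sq_of_noW4Minor (hH : ∀ u v, u ≠ v → (0 : ℝ) < w s(u, v) → H.Adj u v)
    (hW4 : ∀ B₀ A₁ A₂ A₃ A₄ : Set (Fin n),
      (H.induce B₀).Connected → (H.induce A₁).Connected → (H.induce A₂).Connected → (H.induce A₃).Connected →
      (H.induce A₄).Connected →
      Disjoint B₀ A₁ → Disjoint B₀ A₂ → Disjoint B₀ A₃ → Disjoint B₀ A₄ →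
      Disjoint A₁ A₂ → Disjoint A₁ A₃ → Disjoint A₁ A₄ → Disjoint A₂ A₃ → Disjoint A₂ A₄ → Disjoint A₃ A₄ →
      (∃ u ∈ B₀, ∃ v ∈ A₁, H.Adj u v) → (∃ u ∈ B₀, ∃ v ∈ A₂, H.Adj u v) → (∃ u ∈ B₀, ∃ v ∈ A₃, H.Adj u v) →
      (∃ u ∈ B₀, ∃ v ∈ A₄, H.Adj u v) →
      (∃ u ∈ A₁, ∃ v ∈ A₂, H.Adj u v) → (∃ u ∈ A₂, ∃ v ∈ A₃, H.Adj u v) → (∃ u ∈ A₃, ∃ v ∈ A₄, H.Adj u v) →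
      (∃ u ∈ A₄, ∃ v ∈ A₁, H.Adj u v) → False) :
    clusterSquare w a b c ≤ (prodBernoulli w).real (openConn b c)ᶜ ^ 2 :=
  clusterSquare_le_sq_of_noQuadClash_pos w a b c fun _ _ hω hη hab hac hbc hbc' =>
    not_quadClash_of_unlinked₄ H w hH (noCrossLinkage_of_noW4Minor H hW4 a) hω hη hab hac hbc hbc'

/-- **DUU at EVERY root of a `W₄`-minor-free graph**: `μ(a↮b, a↮c, b↮c)² ≤ μ(a↮b, a↮c) · μ(b↮c)²`.
[cite: Gladkov2024, Thm. 5.2 and Thm. 4.3] -/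
theorem sq_real_split_le_of_noW4Minor (hH : ∀ u v, u ≠ v → (0 : ℝ) < w s(u, v) → H.Adj u v)
    (hW4 : ∀ B₀ A₁ A₂ A₃ A₄ : Set (Fin n),
      (H.induce B₀).Connected → (H.induce A₁).Connected → (H.induce A₂).Connected → (H.induce A₃).Connected →
      (H.induce A₄).Connected →
      Disjoint B₀ A₁ → Disjoint B₀ A₂ → Disjoint B₀ A₃ → Disjoint B₀ A₄ →
      Disjoint A₁ A₂ → Disjoint A₁ A₃ → Disjoint A₁ A₄ → Disjoint A₂ A₃ → Disjoint A₂ A₄ → Disjoint A₃ A₄ →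
      (∃ u ∈ B₀, ∃ v ∈ A₁, H.Adj u v) → (∃ u ∈ B₀, ∃ v ∈ A₂, H.Adj u v) → (∃ u ∈ B₀, ∃ v ∈ A₃, H.Adj u v) →
      (∃ u ∈ B₀, ∃ v ∈ A₄, H.Adj u v) →
      (∃ u ∈ A₁, ∃ v ∈ A₂, H.Adj u v) → (∃ u ∈ A₂, ∃ v ∈ A₃, H.Adj u v) → (∃ u ∈ A₃, ∃ v ∈ A₄, H.Adj u v) →
      (∃ u ∈ A₄, ∃ v ∈ A₁, H.Adj u v) → False) :
    (prodBernoulli w).real ((openConn a b)ᶜ ∩ (openConn a c)ᶜ ∩ (openConn b c)ᶜ) ^ 2 ≤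
      (prodBernoulli w).real ((openConn a b)ᶜ ∩ (openConn a c)ᶜ) * (prodBernoulli w).real (openConn b c)ᶜ ^ 2 :=
  sq_real_split_le_of_noQuadClash_pos w a b c fun _ _ hω hη hab hac hbc hbc' =>
    not_quadClash_of_unlinked₄ H w hH (noCrossLinkage_of_noW4Minor H hW4 a) hω hη hab hac hbc hbc'

/-- **TS for EVERY triple of terminals of a `W₄`-minor-free graph**: `μ(a↮b, a↮c, b↮c)² ≤ μ(a↮b) · μ(a↮c) · μ(b↮c)`.
[cite: Gladkov2024, Thm. 5.2, Cor. 5.3 (pattern) and Thm. 4.3] -/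
theorem tripleSplit_of_noW4Minor (hH : ∀ u v, u ≠ v → (0 : ℝ) < w s(u, v) → H.Adj u v)
    (hW4 : ∀ B₀ A₁ A₂ A₃ A₄ : Set (Fin n),
      (H.induce B₀).Connected → (H.induce A₁).Connected → (H.induce A₂).Connected → (H.induce A₃).Connected →
      (H.induce A₄).Connected →
      Disjoint B₀ A₁ → Disjoint B₀ A₂ → Disjoint B₀ A₃ → Disjoint B₀ A₄ →
      Disjoint A₁ A₂ → Disjoint A₁ A₃ → Disjoint A₁ A₄ → Disjoint A₂ A₃ → Disjoint A₂ A₄ → Disjoint A₃ A₄ →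
      (∃ u ∈ B₀, ∃ v ∈ A₁, H.Adj u v) → (∃ u ∈ B₀, ∃ v ∈ A₂, H.Adj u v) → (∃ u ∈ B₀, ∃ v ∈ A₃, H.Adj u v) →
      (∃ u ∈ B₀, ∃ v ∈ A₄, H.Adj u v) →
      (∃ u ∈ A₁, ∃ v ∈ A₂, H.Adj u v) → (∃ u ∈ A₂, ∃ v ∈ A₃, H.Adj u v) → (∃ u ∈ A₃, ∃ v ∈ A₄, H.Adj u v) →
      (∃ u ∈ A₄, ∃ v ∈ A₁, H.Adj u v) → False) :
    (prodBernoulli w).real ((openConn a b)ᶜ ∩ (openConn a c)ᶜ ∩ (openConn b c)ᶜ) ^ 2 ≤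
      (prodBernoulli w).real (openConn a b)ᶜ * (prodBernoulli w).real (openConn a c)ᶜ *
        (prodBernoulli w).real (openConn b c)ᶜ :=
  tripleSplit_of_noQuadClash_pos w a b c fun _ _ hω hη hab hac hbc hbc' =>
    not_quadClash_of_unlinked₄ H w hH (noCrossLinkage_of_noW4Minor H hW4 a) hω hη hab hac hbc hbc'

/-! ### Series-parallel (`K₄`-minor-free) graphs -/

/-- **CSQ at EVERY root of a series-parallel graph** (`H ⊇` positive pairs of `w` has no `K₄` minor: no four pairwise disjoint
vertex sets, each inducing a connected subgraph, pairwise joined by `H`-edges): `clusterSquare w a b c ≤ μ(b ↮ c)²` for all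
`a, b, c`. [cite: Gladkov2024, Thm. 4.3, Def. 4.2, Lemma 3.1, Ex. 2.5; Duffin1965, Thm. 1] -/
theorem clusterSquare_le_sq_of_noK4Minor (hH : ∀ u v, u ≠ v → (0 : ℝ) < w s(u, v) → H.Adj u v)
    (hK4 : ∀ B₀ B₁ B₂ B₃ : Set (Fin n),
      (H.induce B₀).Connected → (H.induce B₁).Connected → (H.induce B₂).Connected → (H.induce B₃).Connected →
      Disjoint B₀ B₁ → Disjoint B₀ B₂ → Disjoint B₀ B₃ → Disjoint B₁ B₂ → Disjoint B₁ B₃ → Disjoint B₂ B₃ →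
      (∃ u ∈ B₀, ∃ v ∈ B₁, H.Adj u v) → (∃ u ∈ B₀, ∃ v ∈ B₂, H.Adj u v) → (∃ u ∈ B₀, ∃ v ∈ B₃, H.Adj u v) →
      (∃ u ∈ B₁, ∃ v ∈ B₂, H.Adj u v) → (∃ u ∈ B₁, ∃ v ∈ B₃, H.Adj u v) → (∃ u ∈ B₂, ∃ v ∈ B₃, H.Adj u v) → False) :
    clusterSquare w a b c ≤ (prodBernoulli w).real (openConn b c)ᶜ ^ 2 :=
  clusterSquare_le_sq_of_noQuadClash_pos w a b c fun _ _ hω hη hab hac hbc hbc' =>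
    not_quadClash_of_unlinked₄ H w hH (noCrossLinkage_of_noK4Minor H hK4 a) hω hη hab hac hbc hbc'

/-- **DUU at EVERY root of a series-parallel graph**: `μ(a↮b, a↮c, b↮c)² ≤ μ(a↮b, a↮c) · μ(b↮c)²`.
[cite: Gladkov2024, Thm. 5.2 and Thm. 4.3; Duffin1965, Thm. 1] -/
theorem sq_real_split_le_of_noK4Minor (hH : ∀ u v, u ≠ v → (0 : ℝ) < w s(u, v) → H.Adj u v)
    (hK4 : ∀ B₀ B₁ B₂ B₃ : Set (Fin n),
      (H.induce B₀).Connected → (H.induce B₁).Connected → (H.induce B₂).Connected → (H.induce B₃).Connected →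
      Disjoint B₀ B₁ → Disjoint B₀ B₂ → Disjoint B₀ B₃ → Disjoint B₁ B₂ → Disjoint B₁ B₃ → Disjoint B₂ B₃ →
      (∃ u ∈ B₀, ∃ v ∈ B₁, H.Adj u v) → (∃ u ∈ B₀, ∃ v ∈ B₂, H.Adj u v) → (∃ u ∈ B₀, ∃ v ∈ B₃, H.Adj u v) →
      (∃ u ∈ B₁, ∃ v ∈ B₂, H.Adj u v) → (∃ u ∈ B₁, ∃ v ∈ B₃, H.Adj u v) → (∃ u ∈ B₂, ∃ v ∈ B₃, H.Adj u v) → False) :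
    (prodBernoulli w).real ((openConn a b)ᶜ ∩ (openConn a c)ᶜ ∩ (openConn b c)ᶜ) ^ 2 ≤
      (prodBernoulli w).real ((openConn a b)ᶜ ∩ (openConn a c)ᶜ) * (prodBernoulli w).real (openConn b c)ᶜ ^ 2 :=
  sq_real_split_le_of_noQuadClash_pos w a b c fun _ _ hω hη hab hac hbc hbc' =>
    not_quadClash_of_unlinked₄ H w hH (noCrossLinkage_of_noK4Minor H hK4 a) hω hη hab hac hbc hbc'

/-- **TS for EVERY triple of terminals of a series-parallel graph**: `μ(a↮b, a↮c, b↮c)² ≤ μ(a↮b) · μ(a↮c) · μ(b↮c)` whenever the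
graph `H` carrying the positive pairs has no `K₄` minor. [cite: Gladkov2024, Thm. 5.2, Cor. 5.3 (pattern) and Thm. 4.3; Duffin1965, Thm. 1] -/
theorem tripleSplit_of_noK4Minor (hH : ∀ u v, u ≠ v → (0 : ℝ) < w s(u, v) → H.Adj u v)
    (hK4 : ∀ B₀ B₁ B₂ B₃ : Set (Fin n),
      (H.induce B₀).Connected → (H.induce B₁).Connected → (H.induce B₂).Connected → (H.induce B₃).Connected →
      Disjoint B₀ B₁ → Disjoint B₀ B₂ → Disjoint B₀ B₃ → Disjoint B₁ B₂ → Disjoint B₁ B₃ → Disjoint B₂ B₃ →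
      (∃ u ∈ B₀, ∃ v ∈ B₁, H.Adj u v) → (∃ u ∈ B₀, ∃ v ∈ B₂, H.Adj u v) → (∃ u ∈ B₀, ∃ v ∈ B₃, H.Adj u v) →
      (∃ u ∈ B₁, ∃ v ∈ B₂, H.Adj u v) → (∃ u ∈ B₁, ∃ v ∈ B₃, H.Adj u v) → (∃ u ∈ B₂, ∃ v ∈ B₃, H.Adj u v) → False) :
    (prodBernoulli w).real ((openConn a b)ᶜ ∩ (openConn a c)ᶜ ∩ (openConn b c)ᶜ) ^ 2 ≤
      (prodBernoulli w).real (openConn a b)ᶜ * (prodBernoulli w).real (openConn a c)ᶜ *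
        (prodBernoulli w).real (openConn b c)ᶜ :=
  tripleSplit_of_noQuadClash_pos w a b c fun _ _ hω hη hab hac hbc hbc' =>
    not_quadClash_of_unlinked₄ H w hH (noCrossLinkage_of_noK4Minor H hK4 a) hω hη hab hac hbc hbc'

end Fin

/-! ### Concrete form: the positive-pair graph of `w` -/

/-- **TS on every weighted series-parallel graph.**  Let `w` be a weight vector on the pairs of `Fin n` whose POSITIVE-PAIR GRAPH
(`u ~ v` iff `u ≠ v` and `0 < w {u,v}`) has no `K₄` minor — no four pairwise disjoint vertex sets, each connected through positive
pairs, pairwise joined by positive pairs.  Then for ALL vertices `a, b, c`: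
`μ(a↮b, a↮c, b↮c)² ≤ μ(a↮b) · μ(a↮c) · μ(b↮c)` (`μ = prodBernoulli w`).
[cite: Gladkov2024, Thm. 5.2, Cor. 5.3 (pattern) and Thm. 4.3; Duffin1965, Thm. 1] -/
theorem tripleSplit_seriesParallel (n : ℕ) (w : Sym2 (Fin n) → unitInterval)
    (hK4 : ∀ B₀ B₁ B₂ B₃ : Set (Fin n),
      ((SimpleGraph.fromRel fun u v : Fin n => (0 : ℝ) < w s(u, v)).induce B₀).Connected →
      ((SimpleGraph.fromRel fun u v : Fin n => (0 : ℝ) < w s(u, v)).induce B₁).Connected →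
      ((SimpleGraph.fromRel fun u v : Fin n => (0 : ℝ) < w s(u, v)).induce B₂).Connected →
      ((SimpleGraph.fromRel fun u v : Fin n => (0 : ℝ) < w s(u, v)).induce B₃).Connected →
      Disjoint B₀ B₁ → Disjoint B₀ B₂ → Disjoint B₀ B₃ → Disjoint B₁ B₂ → Disjoint B₁ B₃ → Disjoint B₂ B₃ →
      (∃ u ∈ B₀, ∃ v ∈ B₁, u ≠ v ∧ (0 : ℝ) < w s(u, v)) → (∃ u ∈ B₀, ∃ v ∈ B₂, u ≠ v ∧ (0 : ℝ) < w s(u, v)) →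
      (∃ u ∈ B₀, ∃ v ∈ B₃, u ≠ v ∧ (0 : ℝ) < w s(u, v)) → (∃ u ∈ B₁, ∃ v ∈ B₂, u ≠ v ∧ (0 : ℝ) < w s(u, v)) →
      (∃ u ∈ B₁, ∃ v ∈ B₃, u ≠ v ∧ (0 : ℝ) < w s(u, v)) → (∃ u ∈ B₂, ∃ v ∈ B₃, u ≠ v ∧ (0 : ℝ) < w s(u, v)) → False)
    (a b c : Fin n) :
    (prodBernoulli w).real ((openConn a b)ᶜ ∩ (openConn a c)ᶜ ∩ (openConn b c)ᶜ) ^ 2 ≤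
      (prodBernoulli w).real (openConn a b)ᶜ * (prodBernoulli w).real (openConn a c)ᶜ *
        (prodBernoulli w).real (openConn b c)ᶜ := by
  let H : SimpleGraph (Fin n) := SimpleGraph.fromRel fun u v => (0 : ℝ) < w s(u, v)
  have hH : ∀ u v, u ≠ v → (0 : ℝ) < w s(u, v) → H.Adj u v := fun u v huv hw =>
    (SimpleGraph.fromRel_adj _ u v).2 ⟨huv, Or.inl hw⟩
  have hH' : ∀ u v, H.Adj u v → u ≠ v ∧ (0 : ℝ) < w s(u, v) := by
    intro u v huv
    rcases (SimpleGraph.fromRel_adj _ u v).1 huv with ⟨hne, e | e⟩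
    · exact ⟨hne, e⟩
    · rw [Sym2.eq_swap] at e; exact ⟨hne, e⟩
  have lift : ∀ B B' : Set (Fin n), (∃ u ∈ B, ∃ v ∈ B', H.Adj u v) → ∃ u ∈ B, ∃ v ∈ B', u ≠ v ∧ (0 : ℝ) < w s(u, v) :=
    fun B B' ⟨u, hu, v, hv, huv⟩ => ⟨u, hu, v, hv, hH' u v huv⟩
  exact tripleSplit_of_noK4Minor w a b c H hH fun B₀ B₁ B₂ B₃ c0 c1 c2 c3 d01 d02 d03 d12 d13 d23 a01 a02 a03 a12 a13 a23 =>
    hK4 B₀ B₁ B₂ B₃ c0 c1 c2 c3 d01 d02 d03 d12 d13 d23 (lift _ _ a01) (lift _ _ a02) (lift _ _ a03) (lift _ _ a12)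
      (lift _ _ a13) (lift _ _ a23)

end Consts

end Summit.CriticalPhenomena.PercolationContinuityZ3.Theorems
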